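import Summits.KontsevichZagierPeriods.KontsevichZagierPeriods.Theses.ComplexOrientations

/-!
# Route KontsevichZagierPeriods/ComplexOrientations — the assembly `Assembly`
# (stmt-KontsevichZagierPeriods-11372)

Problem `KontsevichZagierPeriods`, route `ComplexOrientations` (complex orientations integrate:
Rokhlin's type decides which oval-area identities a real curve over `ℚ̄` carries), item
stmt-KontsevichZagierPeriods-11372 (`Assembly`, assembly, rank 1). The route declaration
`Assembly` is the curried implication

  `TypeOneIdentities → OvalSector → CauchyMove → OrientationKernel → KontsevichZagierPeriods`.

Pure bookkeeping over the Kontsevich–Zagier calculus of moves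
(`Literature.NumberTheory.Transcendental.KZCalculus`):
* the summit `KontsevichZagierPeriods` (= `Literature.Periods.KZPeriodConjecture`) asks, for two
  rational-shape representations `r, r'` with `r.value = r'.value`, that `KZ.Equivalent r r'`,
  i.e. `[r] - [r'] ∈ KZ.relations`;
* equal values give `KZ.eval ([r] - [r']) = 0` (`map_sub`, `KZ.eval_of`);
* the enlarged-kernel target `OrientationKernel`, specialised to the subgroup
  `R := KZ.relations` (admissible by `le_rfl`), demands that `R` contain the three families of
  relators of the route — the type-I unit-sign oval identities, the integer oval-sector
  identities, and the Cauchy relators of algebraic germs on rational circles — and these three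
  demands are, verbatim, the three engine hypotheses `TypeOneIdentities`, `OvalSector`,
  `CauchyMove`; it then puts every element of `ker KZ.eval`, in particular `[r] - [r']`, in
  `KZ.relations`.

The term is the same as the route's kernel-checked deciding theorem
`Summit.KontsevichZagierPeriods.KontsevichZagierPeriods.Theses.ComplexOrientations.closes`
(route file, D-0027 §2.1), re-proved here self-containedly so that the item is closed by a
`Theorems` declaration whose type is literally the route declaration. The rationality hypotheses
on `r, r'` are not used.

Sources: M. Kontsevich, D. Zagier, *Periods* (2001), §1.2 (Conjecture 1, rules 1–3, and the
kernel reformulation); A. Huber, S. Müller-Stach, *Periods and Nori Motives* (2017), §13.1.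
Deliberately NOT here: any claim about the four hypotheses themselves — the result is the
implication only (unconditional as an implication; `OrientationKernel` is of period-conjecture
strength modulo the three engines and open, `TypeOneIdentities` / `OvalSector` are open cruxes).
-/

namespace Summit.KontsevichZagierPeriods.ComplexOrientations

open Summit.KontsevichZagierPeriods.KontsevichZagierPeriods.Theses.ComplexOrientations

/-- Settles stmt-KontsevichZagierPeriods-11372: the route declaration `ComplexOrientations.Assembly`
(`TypeOneIdentities → OvalSector → CauchyMove → OrientationKernel → KontsevichZagierPeriods`)
holds. For representations `r, r'` with equal values, `KZ.eval ([r] - [r']) = 0`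
(`KZ.eval_of`); the enlarged-kernel hypothesis `OrientationKernel` at the admissible subgroup
`R := KZ.relations` (`le_rfl`), fed the three engines `TypeOneIdentities`, `OvalSector`,
`CauchyMove` as its three relator-containment demands, yields `[r] - [r'] ∈ KZ.relations`, i.e.
`KZ.Equivalent r r'`. The rationality hypotheses are not used; this is the route's deciding
theorem `closes` read as a closed term. [Kontsevich–Zagier 2001, §1.2] [folklore] -/
theorem assembly_proof :
    Summit.KontsevichZagierPeriods.KontsevichZagierPeriods.Theses.ComplexOrientations.Assembly := by
  unfold Summit.KontsevichZagierPeriods.KontsevichZagierPeriods.Theses.ComplexOrientations.Assembly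
  intro h1 h2 h3 hK n m r r' _ _ hv
  -- equal values: the formal difference is in the kernel of `KZ.eval`
  have h0 : Literature.NumberTheory.Transcendental.KZ.eval
      (Literature.NumberTheory.Transcendental.KZ.of r -
        Literature.NumberTheory.Transcendental.KZ.of r') = 0 := by
    rw [map_sub, Literature.NumberTheory.Transcendental.KZ.eval_of,
      Literature.NumberTheory.Transcendental.KZ.eval_of, hv, sub_self]
  -- the enlarged kernel at `R := KZ.relations`, the three engines supplying the relators
  exact hK Literature.NumberTheory.Transcendental.KZ.relations le_rfl h1 h2 h3 _ h0

end Summit.KontsevichZagierPeriods.ComplexOrientations
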